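import Mathlib
import Summits.CriticalPhenomena.SAWScalingLimit.Theses.SAWDefectDecoherence
import Summits.CriticalPhenomena.SAWScalingLimit.Theorems.ObservableToSLE.Negative.Identification
import Summits.CriticalPhenomena.SAWScalingLimit.Theorems.SAWDefectDecoherenceObservableToSLERGateDecomposition
import Summits.CriticalPhenomena.SAWScalingLimit.Theorems.SAWDefectDecoherenceObservableToSLERNestedTransferProductCells
import Summits.CriticalPhenomena.SAWScalingLimit.Theorems.SAWDefectDecoherenceObservableToSLERGateTransferPerCell
import Summits.CriticalPhenomena.SAWScalingLimit.Theorems.SAWDefectDecoherenceObservableToSLERMidTightSubarc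
import Summits.CriticalPhenomena.SAWScalingLimit.Theorems.SAWDefectDecoherenceObservableToSLERMidTightN

/-!
# Averaged injectivity modulus of the carved middle pieces (`HexUniformModulus → MidModulusN`)

Stub `stub_midModulusN` (stub 5b' of reshape r7) of the line `bridge-gate-renewal` for the crux
`Summit.CriticalPhenomena.SAWScalingLimit.Theses.SAWDefectDecoherence.ObservableToSLER`
(item `stmt-CriticalPhenomena-14005`).  The line re-roots the critical hexagonal SAW at its first
good gates of tame nested families; reshape r7 threads the injectivity MODULUS of the carved middle
laws like their tightness: the sequential reduction (stub 5c, `stub_seqReductionPM`) consumes,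
besides the averaged tightness `MidTightN` (landed, `…MidTightN.lean`), the AVERAGED MODULUS proved
here.  For every `ε, η > 0` there is `θ > 0` such that, for all small meshes and ALL tame nested
families, the walks whose first good gates carve a middle law putting mass `> η` outside the
modulus event `CurveClass.modulusClass ε θ` (two `θ`-close points of the curve bound an arc staying
`ε`-close to its start) have `hexSAWLaw`-mass `≤ η`.

Proof (port of `stub_midTightN`, with the Aizenman–Burchard sub-arc compactness replaced by the
trivial SUB-ARC INHERITANCE of injectivity moduli).
* `MidTight.mem_modulusSet_of_mem_subcurves` — a sub-curve `γ ∘ φ` (`φ` a monotone clock) of a curve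
  in `Curve.modulusSet ε θ` lies in `Curve.modulusSet ε θ` (restrict the quantifiers);
* `MidTight.polyline_middle_mem_modulusClass` — hence the class of `polyline M` lies in
  `modulusClass ε θ` whenever the class of `polyline (P ++ M ++ S)` does: the middle polyline is,
  modulo reparametrisation, a sub-curve of the long one
  (`MidTight.exists_mem_subcurves_polyline_middle`, landed in `…MidTightSubarc.lean`), and
  `modulusClass` membership is membership of any representative
  (`CurveClass.mk_mem_modulusClass_iff`);
* `stub_midModulusN` — `R₃ := R₁` of `eventually_productCellN`; `HexUniformModulus` at `(ε, η²)`
  gives `θ`; per mesh, the Markov estimate over the product cells `measure_badCarved_mul_le`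
  (landed in `…MidTightN.lean`, generic in the pair of events) with `GateDecomposition`
  (`stub_gateDecomposition`, p82259) and `𝒦₀ = 𝒦 = modulusClass ε θ` gives
  `η · P(bad) ≤ P(curve ∉ modulusClass ε θ) ≤ η²`, hence `P(bad) ≤ η`.
-/

noncomputable section

open scoped BigOperators Topology NNReal ENNReal Classical unitInterval
open Filter Set MeasureTheory Metric

/-! ### Sub-arc inheritance of injectivity moduli -/

namespace Summit.CriticalPhenomena.SAWScalingLimit.Theorems.ObservableToSLER.NestedGate.MidTight

open Literature.Probability.RandomPlanarGeometry
open Literature.Probability.LatticeModels (polyline)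

section Subcurve

variable {E : Type*} [PseudoMetricSpace E]

/-- **Sub-curves inherit injectivity moduli**: if `γ' t = γ (φ t)` for a monotone clock `φ` and
`γ ∈ Curve.modulusSet ε θ`, then `γ' ∈ Curve.modulusSet ε θ` (for `s ≤ u ≤ t` the clock times
`φ s ≤ φ u ≤ φ t` are admissible in the defining property of `γ`). -/
theorem mem_modulusSet_of_mem_subcurves {ε θ : ℝ} {γ' γ : Curve E} (h : γ' ∈ subcurves γ)
    (hγ : γ ∈ (Curve.modulusSet ε θ : Set (Curve E))) :
    γ' ∈ (Curve.modulusSet ε θ : Set (Curve E)) := by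
  obtain ⟨φ, hφm, hφ⟩ := h
  intro s u t hsu hut hd
  rw [hφ s, hφ u]
  rw [hφ s, hφ t] at hd
  exact hγ (φ s) (φ u) (φ t) (hφm hsu) (hφm hut) hd

end Subcurve

section Polyline

variable {E : Type*} [NormedAddCommGroup E] [NormedSpace ℝ E]

/-- **The middle piece of a polyline inherits the injectivity modulus of the whole polyline**: if
the class of `polyline (P ++ M ++ S)` lies in `CurveClass.modulusClass ε θ` then so does the class
of `polyline M`.  For `M ≠ []` the middle polyline is, modulo reparametrisation, a sub-curve of the
long polyline (`exists_mem_subcurves_polyline_middle`) and sub-curves inherit moduli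
(`mem_modulusSet_of_mem_subcurves`); for `M = []` the junk constant polyline has every modulus
`(ε, θ)` with `0 ≤ ε`, and `0 ≤ ε` follows from the hypothesis at `s = u = t` unless `θ ≤ 0`
(when every curve has modulus `(ε, θ)`). -/
theorem polyline_middle_mem_modulusClass {ε θ : ℝ} (P M S : List E)
    (h : CurveClass.mk ⟨polyline (P ++ M ++ S)⟩ ∈ (CurveClass.modulusClass ε θ : Set (CurveClass E))) :
    CurveClass.mk ⟨polyline M⟩ ∈ (CurveClass.modulusClass ε θ : Set (CurveClass E)) := by
  have hmem := CurveClass.mk_mem_modulusClass_iff.1 h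
  rcases eq_or_ne M [] with rfl | hM
  · refine CurveClass.mk_mem_modulusClass_iff.2 fun s u t _ _ hd => ?_
    have h0 : ∀ x y : I, dist ((⟨polyline ([] : List E)⟩ : Curve E) x)
        ((⟨polyline ([] : List E)⟩ : Curve E) y) = 0 := fun x y => by
      show dist (0 : E) 0 = 0
      exact dist_self _
    rw [h0] at hd ⊢
    have h1 := hmem 0 0 0 le_rfl le_rfl (by rwa [dist_self])
    rwa [dist_self] at h1
  · obtain ⟨γ₃, h₃, hsub₃⟩ := exists_mem_subcurves_polyline_middle P M S hM
    rw [← h₃, CurveClass.mk_mem_modulusClass_iff]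
    exact mem_modulusSet_of_mem_subcurves hsub₃ hmem

end Polyline

end Summit.CriticalPhenomena.SAWScalingLimit.Theorems.ObservableToSLER.NestedGate.MidTight

/-! ### The stub -/

namespace Summit.CriticalPhenomena.SAWScalingLimit.Theorems.ObservableToSLER.NestedGate

open Literature.Probability.LatticeModels (HexVertex hexGraph hexCenter triZeta Site polyline)
open Literature.Probability.RandomPlanarGeometry
open Literature.Probability.RandomPlanarGeometry.SAW
open Summit.CriticalPhenomena.SAWScalingLimit.Theorems.ObservableToSLER.BridgeGate

/-- **Sub-arc inheritance of injectivity moduli for rescaled lattice polylines**: if the class of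
the rescaled polyline through `l₁ ++ mid ++ l₂` lies in `modulusClass ε θ` then so does the class
of the rescaled polyline through `mid` (`MidTight.polyline_middle_mem_modulusClass` after
`List.map_append`). -/
theorem polyClass_middle_mem_modulusClass {ε θ : ℝ} (δ : ℝ) (l₁ mid l₂ : List HexVertex)
    (h : polyClass δ (l₁ ++ mid ++ l₂) ∈ (CurveClass.modulusClass ε θ : Set (CurveClass ℂ))) :
    polyClass δ mid ∈ (CurveClass.modulusClass ε θ : Set (CurveClass ℂ)) := by
  have h' := MidTight.polyline_middle_mem_modulusClass (ε := ε) (θ := θ)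
    (l₁.map fun v => (δ : ℂ) * hexCenter v) (mid.map fun v => (δ : ℂ) * hexCenter v)
    (l₂.map fun v => (δ : ℂ) * hexCenter v)
  rw [← List.map_append, ← List.map_append] at h'
  exact h' h

/-- **STUB 5b' of the line `bridge-gate-renewal` (reshape r7) — `HexUniformModulus → MidModulusN`,
the AVERAGED INJECTIVITY MODULUS OF THE CARVED MIDDLE PIECES.**  For every `ε, η > 0` there is
`θ > 0` such that for all small meshes and ALL tame nested families the walks whose first good
gates carve a middle law putting mass `> η` outside `CurveClass.modulusClass ε θ` have
`hexSAWLaw`-mass `≤ η`.  Proof: `R₃ := R₁` of `eventually_productCellN`; the hypothesis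
(`HexUniformModulus`) at `(ε, η²)` gives `θ`; per mesh, `measure_badCarved_mul_le` (Markov over the
product cells, with `GateDecomposition` = `stub_gateDecomposition`, p82259) for the pair of events
`𝒦₀ = 𝒦 = modulusClass ε θ` — admissible by the sub-arc inheritance
`polyClass_middle_mem_modulusClass` — gives `η · P(bad) ≤ P(curve ∉ modulusClass ε θ) ≤ η²`. -/
theorem stub_midModulusN :
    (∀ (D : DobrushinDomain) (a b : ℝ → HexVertex), IsEmbEndpointApprox hexGraph hexCenter D a b →
      ∀ ε > (0 : ℝ), ∀ η > (0 : ℝ), ∃ θ > (0 : ℝ), ∀ᶠ δ : ℝ in 𝓝[>] 0,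
        hexSAWLaw D.carrier δ (a δ) (b δ) {γ | γ.curve ∉ CurveClass.modulusClass ε θ} ≤
          ENNReal.ofReal η) →
    ∀ (D : DobrushinDomain) (a b : ℝ → HexVertex), IsEmbEndpointApprox hexGraph hexCenter D a b →
      ∃ R₃ > (0 : ℝ), ∀ R ∈ Set.Ioc (0 : ℝ) R₃, ∀ ρ > (0 : ℝ), ∀ N : ℕ, ∀ ε > (0 : ℝ), ∀ η > (0 : ℝ),
        ∃ θ > (0 : ℝ),
          ∀ᶠ δ : ℝ in 𝓝[>] 0, ∀ S T : ℕ → Set HexVertex,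
            TameNestedFamily δ R N (a δ) S → TameNestedFamily δ R N (b δ) T →
            hexSAWLaw D.carrier δ (a δ) (b δ)
              {γ | ∃ (n m : ℕ) (p q : HexVertex) (n' m' : ℕ) (p' q' : HexVertex),
                  IsFirstGoodGateN D.carrier δ ρ R S (a δ) γ.walk.support n m p q ∧
                  IsFirstGoodGateN D.carrier δ ρ R T (b δ) γ.walk.support.reverse n' m' p' q' ∧
                  ENNReal.ofReal η <
                    carvedLaw D.carrier δ (S n ∪ T n') q q'
                      {ξ | ξ.curve ∉ CurveClass.modulusClass ε θ}} ≤
              ENNReal.ofReal η := by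
  intro hM D a b hab
  obtain ⟨R₁, hR₁, hcells⟩ := eventually_productCellN D a b hab
  refine ⟨R₁, hR₁, fun R hR ρ _ N ε hε η hη => ?_⟩
  -- the modulus of the whole curves at level `η²`
  obtain ⟨θ, hθ, hmod⟩ := hM D a b hab ε hε (η * η) (mul_pos hη hη)
  refine ⟨θ, hθ, ?_⟩
  filter_upwards [hcells R hR ρ N, hmod, self_mem_nhdsWithin] with δ hcs hKδ hδ
  intro S T hS hT'
  have hδ0 : 0 < δ := hδ
  have key := measure_badCarved_mul_le (ρ := ρ) (R := R) (S := S) (T := T) D.isBounded hδ0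
    (stub_gateDecomposition D.carrier δ (a δ) (b δ)) (hcs S T hS hT')
    (𝒦₀ := CurveClass.modulusClass ε θ) (CurveClass.measurableSet_modulusClass ε θ)
    (fun l₁ mid l₂ h => polyClass_middle_mem_modulusClass δ l₁ mid l₂ h) (ENNReal.ofReal η)
  have hK' : hexSAWLaw D.carrier δ (a δ) (b δ) {γ | γ.curve ∉ CurveClass.modulusClass ε θ} ≤
      ENNReal.ofReal η * ENNReal.ofReal η := by
    rw [← ENNReal.ofReal_mul hη.le]
    exact hKδ
  have hη0 : ENNReal.ofReal η ≠ 0 := (ENNReal.ofReal_pos.2 hη).ne'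
  exact (ENNReal.mul_le_mul_iff_left hη0 ENNReal.ofReal_ne_top).1 (key.trans hK')

end Summit.CriticalPhenomena.SAWScalingLimit.Theorems.ObservableToSLER.NestedGate

end
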